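import Summits.CriticalPhenomena.SAWScalingLimit.Theorems.SAWRenewalTightnessKestenIdentity
import Literature.Probability.RandomPlanarGeometry.SelfAvoidingWalkProofs

/-!
# Tilted Kraft inequality for confined irreducible bridges: the unconditional basics

Helper file for line `kesten-defect-renewal` of crux `SAWRenewalTightness.ShellCrossingBound`
(item stmt-CriticalPhenomena-4728), stub S1 `stub_irrBridgeTiltedKraft`. S1 asks for ONE `c > 0`
such that for every width `W ≥ 1`, start height `0 ≤ y < W` and finite set `s` of irreducible
bridge words (`SAW.IsIrrBridge`), the members of `s` fitting in heights `[0, W)` from `y` satisfy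
`Σ x_c^{|β|} · exp (c · span β / W) ≤ 1` (`span = SAW.xEnd`, `x_c = SAW.criticalFugacity`).
Its content is the UNIFORMITY of `c` in `W` (strip hyperscaling `ξ_W(x_c) = O(W)`, open). What is
unconditional is recorded here, each statement over the explicit sum of the registered stub:

* `TiltedKraft.fittingSum_le_one`, `tiltedKraft_zero` — the untilted / `c = 0` instance holds for
  every `W, y, s`: drop the fitting filter and the subtype, then Kesten's `A(z_c) ≤ 1`
  (`KestenIdentity.partialSum_le_one`, Madras–Slade (4.2.4)). So ALL content of S1 is the tilt.
* `TiltedKraft.tiltedSum_mono`, `tiltedKraft_mono`, `tiltedKraft_anti` — the tilted sum is monotone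
  in `c` (spans of bridges are `≥ 0`), so the inequality, and the `∀ W y s` statement, are downward
  closed in `c`: S1 is the claim `inf_W c_K(W) > 0` for the row-sum (Kraft) thresholds `c_K(W)`.
* `TiltedKraft.eq_single_of_height_zero`, `tiltedKraft_width_one` — width `W = 1`: an irreducible
  bridge all of whose heights vanish is the one-step bridge `[+e₀]` (horizontal steps only, no
  immediate reversal by self-avoidance, first step `+e₀` by the bridge condition, and `E^k` with
  `k ≥ 2` has the break point `1`), so the width-one tilted sum is `x_c · e^{c}` and the sharp
  width-one threshold is `c_K(1) = log μ`; with the elementary `x_c ≤ 1/2`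
  (`criticalFugacity_le_half`) the inequality holds at `c = log 2`.
* `TiltedKraft.isIrrBridge_hook`, `TiltedKraft.fittingSum_add_pow_le_one` — the confinement defect
  is positive at every `(W, y)`: the hook `E N^W` is an irreducible bridge (span `1`, length
  `W + 1`) that leaves the strip from every start height, so `Σ_{fits} x_c^{|β|} ≤ 1 - x_c^{W+1}`.
  This trivial margin is exponentially small; S1 needs one of the order `W⁻¹ Σ_{fits} x_c^{|β|} span`.
* `fittingSum_le_exp_neg_of_tiltedKraft`, `fittingSum_add_firstMoment_le_of_tiltedKraft` — what S1
  demands (necessary conditions): the registered inequality at `c` forces the untilted fitting sum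
  to be `≤ e^{-c/W}` (a defect `≥ 1 - e^{-c/W} ≈ c/W`, polynomial in `W`) and the first span moment
  `(c/W) Σ_{fits} x_c^{|β|} span β` to be `≤ 1 - Σ_{fits} x_c^{|β|}`.

Sources: H. Kesten, J. Math. Phys. 4 (1963), §4; N. Madras, G. Slade, *The Self-Avoiding Walk*
(1993), §4.2 (4.2.1)–(4.2.4), Thm 8.2.1; line card `Cruxes/ShellCrossingBound/Lines/kesten-defect-renewal.md`.
-/

open Finset Literature.Probability.LatticeModels
open Literature.Probability.RandomPlanarGeometry
open scoped BigOperators Classical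

namespace Summit.CriticalPhenomena.SAWScalingLimit.Theorems

namespace TiltedKraft

open Literature.Probability.RandomPlanarGeometry.SAW

/-! ## The untilted sum -/

/-- **Untilted Kraft inequality for confined irreducible bridges**: for every width `W`, start
height `y` and finite set `s` of irreducible bridge words, the members of `s` fitting in heights
`[0, W)` from `y` have `Σ x_c^{|β|} ≤ 1` — forget the confinement and apply Kesten's
`A(z_c) ≤ 1` (`KestenIdentity.partialSum_le_one`). [cite: MadrasSlade1993, §4.2, eq. (4.2.4)] -/
theorem fittingSum_le_one (W : ℕ) (y : ℤ) (s : Finset {w : List Step // IsIrrBridge w}) :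
    (∑ w ∈ s with (∀ i ≤ w.1.length, 0 ≤ y + traj w.1 i 1 ∧ y + traj w.1 i 1 < W),
      criticalFugacity ^ w.1.length) ≤ 1 := by
  calc (∑ w ∈ s with (∀ i ≤ w.1.length, 0 ≤ y + traj w.1 i 1 ∧ y + traj w.1 i 1 < W),
          criticalFugacity ^ w.1.length)
      ≤ ∑ w ∈ s, criticalFugacity ^ w.1.length :=
        Finset.sum_le_sum_of_subset_of_nonneg (Finset.filter_subset _ _)
          fun _ _ _ => pow_nonneg KestenIdentity.criticalFugacity_nonneg _
    _ = ∑ v ∈ s.map (Function.Embedding.subtype _), criticalFugacity ^ v.length := by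
        rw [Finset.sum_map]
        rfl
    _ ≤ 1 := KestenIdentity.partialSum_le_one _ fun v hv => by
        obtain ⟨w, -, rfl⟩ := Finset.mem_map.1 hv
        exact w.2

/-! ## Monotonicity in the tilt parameter -/

/-- The tilted sum `Σ_{fits} x_c^{|β|} exp (c · span β / W)` is monotone in `c`: spans of bridges
are non-negative (`IsBridgeW.xEnd_nonneg`) and `exp` is monotone. [folklore] -/
theorem tiltedSum_mono {c c' : ℝ} (hc : c' ≤ c) (W : ℕ) (y : ℤ)
    (s : Finset {w : List Step // IsIrrBridge w}) :
    (∑ w ∈ s with (∀ i ≤ w.1.length, 0 ≤ y + traj w.1 i 1 ∧ y + traj w.1 i 1 < W),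
        criticalFugacity ^ w.1.length * Real.exp (c' * (xEnd w.1 : ℝ) / W)) ≤
      ∑ w ∈ s with (∀ i ≤ w.1.length, 0 ≤ y + traj w.1 i 1 ∧ y + traj w.1 i 1 < W),
        criticalFugacity ^ w.1.length * Real.exp (c * (xEnd w.1 : ℝ) / W) := by
  refine Finset.sum_le_sum fun w _ => mul_le_mul_of_nonneg_left ?_
    (pow_nonneg KestenIdentity.criticalFugacity_nonneg _)
  refine Real.exp_le_exp.2 (div_le_div_of_nonneg_right ?_ (Nat.cast_nonneg W))
  have h0 : (0 : ℝ) ≤ (xEnd w.1 : ℝ) := by exact_mod_cast w.2.bridge.xEnd_nonneg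
  exact mul_le_mul_of_nonneg_right hc h0

/-! ## Width one: only the one-step bridge fits -/

/-- A step with vanishing second coordinate is `+e₀` or `-e₀`. [folklore] -/
theorem step_eq_of_dy_eq_zero : ∀ d : Step, Step.dy d = 0 → d = 0 ∨ d = 2 := by decide

/-- Along a word all of whose heights vanish every step is horizontal. [folklore] -/
theorem getElem_eq_zero_or_two {w : List Step} (h : ∀ i ≤ w.length, traj w i 1 = 0) {i : ℕ}
    (hi : i < w.length) : w[i] = 0 ∨ w[i] = 2 := by
  have h1 := h i hi.le
  have h2 := h (i + 1) hi
  rw [traj_succ w hi, Pi.add_apply, h1, zero_add, Step.vec_apply_one] at h2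
  exact step_eq_of_dy_eq_zero _ h2

/-- A self-avoiding word has no immediate reversal `+e₀, -e₀`. [folklore] -/
theorem not_reversal {w : List Step} (hs : IsSAW w) {i : ℕ} (hi : i + 1 < w.length)
    (h0 : w[i] = 0) (h2 : w[i + 1] = 2) : False := by
  rw [isSAW_iff_injOn] at hs
  have hv : Step.vec 0 + Step.vec 2 = 0 := by decide
  have key : traj w (i + 1 + 1) = traj w i := by
    rw [traj_succ w hi, traj_succ w (Nat.lt_of_succ_lt hi), h0, h2, add_assoc, hv, add_zero]
  have := hs (show i + 1 + 1 ≤ w.length by omega) (show i ≤ w.length by omega) key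
  omega

/-- **In width one only `[+e₀]` fits**: an irreducible bridge all of whose heights vanish is the
one-step bridge. Its steps are horizontal; the first is `+e₀` (bridge: `x(1) > 0`); a `-e₀`
after a `+e₀` would revisit a vertex; so the word is `(+e₀)^k`, whose first coordinates are
`x(i) = i`, and for `k ≥ 2` the time `1` is a break point. [cite: MadrasSlade1993, §4.2, eq. (4.2.1)] -/
theorem eq_single_of_height_zero {w : List Step} (hw : IsIrrBridge w)
    (h : ∀ i ≤ w.length, traj w i 1 = 0) : w = [0] := by
  -- every step is `+e₀`
  have hE : ∀ i (hi : i < w.length), w[i] = 0 := by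
    intro i
    induction i with
    | zero =>
      intro hi
      rcases getElem_eq_zero_or_two h hi with h0 | h2
      · exact h0
      · exfalso
        have hx := ((isBridgeW_iff w).1 hw.bridge 1 le_rfl hi).1
        rw [xAt_succ w hi, xAt_zero, h2] at hx
        revert hx
        decide
    | succ i ih =>
      intro hi
      rcases getElem_eq_zero_or_two h hi with h0 | h2
      · exact h0
      · exact (not_reversal hw.saw hi (ih (Nat.lt_of_succ_lt hi)) h2).elim
  -- hence `x(i) = i`
  have hx : ∀ i ≤ w.length, xAt w i = i := by
    intro i
    induction i with
    | zero => intro; simp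
    | succ i ih =>
      intro hi
      rw [xAt_succ w hi, ih (Nat.le_of_succ_le hi), hE i hi, show Step.dx 0 = 1 from rfl]
      push_cast
      ring
  -- so the length is `1`, since otherwise `1` is a break point
  have h1 : 1 ≤ w.length := List.length_pos_iff.2 hw.ne_nil
  have hlen : w.length = 1 := by
    by_contra hne
    refine hw.irr 1 ⟨one_pos, by omega, fun i hi => ?_, fun i hi1 hi2 => ?_⟩
    · rw [hx i (hi.trans h1), hx 1 h1]
      exact_mod_cast hi
    · rw [hx i hi2, hx 1 h1]
      exact_mod_cast hi1
  obtain ⟨a, rfl⟩ := List.length_eq_one_iff.1 hlen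
  have := hE 0 (by simp)
  simpa using this

/-- The span of the one-step bridge is `1`. [folklore] -/
theorem xEnd_single : xEnd [(0 : Step)] = 1 := by decide

/-! ## The defect is positive: the hook `E N^W` is an irreducible bridge that never fits -/

/-- Coordinates along the hook `E N^k = [+e₀, +e₁, …, +e₁]`: after `i ≥ 1` steps it sits at
`(1, i - 1)`. [folklore] -/
theorem traj_hook (k : ℕ) : ∀ i, 1 ≤ i → i ≤ k + 1 →
    traj ((0 : Step) :: List.replicate k 1) i 0 = 1 ∧
      traj ((0 : Step) :: List.replicate k 1) i 1 = (i : ℤ) - 1 := by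
  intro i
  induction i with
  | zero => intro h; omega
  | succ i ih =>
    intro _ hi
    have hi' : i < ((0 : Step) :: List.replicate k 1).length := by
      rw [List.length_cons, List.length_replicate]; omega
    rw [traj_succ _ hi']
    rcases Nat.eq_zero_or_pos i with rfl | hpos
    · simp only [traj_zero, zero_add, List.getElem_cons_zero, Step.vec_apply_zero,
        Step.vec_apply_one]
      exact ⟨rfl, rfl⟩
    · obtain ⟨h0, h1⟩ := ih hpos (Nat.le_of_succ_le hi)
      have hget : ((0 : Step) :: List.replicate k 1)[i] = 1 := by
        obtain ⟨j, rfl⟩ : ∃ j, i = j + 1 := ⟨i - 1, by omega⟩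
        rw [List.getElem_cons_succ, List.getElem_replicate]
      simp only [Pi.add_apply, h0, h1, hget, Step.vec_apply_zero, Step.vec_apply_one]
      refine ⟨rfl, ?_⟩
      rw [show Step.dy 1 = 1 from rfl]
      push_cast
      ring

/-- **The hook `E N^k` is an irreducible bridge**: self-avoiding (heights strictly increase along
the column `x = 1`), a bridge of span `1` (`x(i) = 1` for `i ≥ 1`), and without break point (the
first coordinate never increases strictly after time `1`). [cite: MadrasSlade1993, §4.2, Definition 4.2.1] -/
theorem isIrrBridge_hook (k : ℕ) : IsIrrBridge ((0 : Step) :: List.replicate k 1) := by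
  have hlen : ((0 : Step) :: List.replicate k 1).length = k + 1 := by
    rw [List.length_cons, List.length_replicate]
  refine ⟨?_, ?_, ?_, List.cons_ne_nil _ _⟩
  · rw [isSAW_iff_injOn]
    intro i hi j hj hij
    simp only [Set.mem_setOf_eq, hlen] at hi hj
    rcases Nat.eq_zero_or_pos i with rfl | hi0 <;> rcases Nat.eq_zero_or_pos j with rfl | hj0
    · rfl
    · have := congrFun hij 0
      rw [traj_zero, (traj_hook k j hj0 hj).1] at this
      exact absurd this (by decide)
    · have := congrFun hij 0
      rw [traj_zero, (traj_hook k i hi0 hi).1] at this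
      exact absurd this (by decide)
    · have := congrFun hij 1
      rw [(traj_hook k i hi0 hi).2, (traj_hook k j hj0 hj).2] at this
      omega
  · rw [isBridgeW_iff]
    intro i h1 h2
    rw [hlen] at h2
    simp only [xEnd, xAt, hlen, (traj_hook k i h1 h2).1, (traj_hook k (k + 1) le_add_self le_rfl).1]
    exact ⟨one_pos, le_rfl⟩
  · rintro j ⟨hj0, hjl, -, hgt⟩
    rw [hlen] at hjl
    have := hgt (k + 1) hjl hlen.ge
    simp only [xAt, (traj_hook k j hj0 hjl.le).1, (traj_hook k (k + 1) le_add_self le_rfl).1] at this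
    exact lt_irrefl _ this

/-- From any start height `y ≥ 0` the hook `E N^W` leaves the strip of heights `[0, W)` (its last
vertex has height `y + W`). [folklore] -/
theorem hook_not_fits (W : ℕ) {y : ℤ} (hy : 0 ≤ y) :
    ¬ ∀ i ≤ ((0 : Step) :: List.replicate W 1).length,
      0 ≤ y + traj ((0 : Step) :: List.replicate W 1) i 1 ∧
        y + traj ((0 : Step) :: List.replicate W 1) i 1 < W := by
  intro h
  have hlen : ((0 : Step) :: List.replicate W 1).length = W + 1 := by
    rw [List.length_cons, List.length_replicate]
  have := (h (W + 1) hlen.ge).2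
  rw [(traj_hook W (W + 1) le_add_self le_rfl).2] at this
  push_cast at this
  omega

/-- **The confinement defect is positive, quantitatively**: for every width `W`, start height
`y ≥ 0` and finite `s`, `Σ_{fits} x_c^{|β|} + x_c^{W+1} ≤ 1` — add the non-fitting irreducible
bridge `E N^W` (length `W + 1`) to the fitting members of `s` and apply `A(z_c) ≤ 1`. This margin
is exponentially small in `W`; S1 needs a margin of the order of the first span moment
`W⁻¹ Σ_{fits} x_c^{|β|} span β` (predicted `≍ W^{-3/4}`). [cite: MadrasSlade1993, §4.2, eq. (4.2.4)] -/
theorem fittingSum_add_pow_le_one (W : ℕ) {y : ℤ} (hy : 0 ≤ y)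
    (s : Finset {w : List Step // IsIrrBridge w}) :
    (∑ w ∈ s with (∀ i ≤ w.1.length, 0 ≤ y + traj w.1 i 1 ∧ y + traj w.1 i 1 < W),
      criticalFugacity ^ w.1.length) + criticalFugacity ^ (W + 1) ≤ 1 := by
  set T := (s.filter fun w => ∀ i ≤ w.1.length, 0 ≤ y + traj w.1 i 1 ∧ y + traj w.1 i 1 < W).map
    (Function.Embedding.subtype _) with hT
  have hnot : ((0 : Step) :: List.replicate W 1) ∉ T := by
    intro hmem
    obtain ⟨w, hw, hw'⟩ := Finset.mem_map.1 hmem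
    have hfit := (Finset.mem_filter.1 hw).2
    refine hook_not_fits W hy ?_
    rw [← hw']
    exact hfit
  have h := KestenIdentity.partialSum_le_one (insert ((0 : Step) :: List.replicate W 1) T)
    fun v hv => by
      rcases Finset.mem_insert.1 hv with rfl | hv
      · exact isIrrBridge_hook W
      · obtain ⟨w, -, rfl⟩ := Finset.mem_map.1 hv
        exact w.2
  rw [Finset.sum_insert hnot, List.length_cons, List.length_replicate, hT, Finset.sum_map] at h
  rw [add_comm]
  exact h

end TiltedKraft

open TiltedKraft

/-! ## The statements over the registered sum -/

/-- **S1 at `c = 0`**: the untilted instance of the registered tilted Kraft inequality holds for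
every `W`, `y` and `s` (no hypotheses on `W, y` needed): `exp (0 · span / W) = 1` and
`TiltedKraft.fittingSum_le_one`. All content of S1 is therefore the uniform positive tilt.
[cite: MadrasSlade1993, §4.2, eq. (4.2.4)] -/
theorem tiltedKraft_zero :
    ∀ W : ℕ, ∀ y : ℤ, ∀ s : Finset {w : List SAW.Step // SAW.IsIrrBridge w},
      (∑ w ∈ s with (∀ i ≤ w.1.length, 0 ≤ y + SAW.traj w.1 i 1 ∧ y + SAW.traj w.1 i 1 < W),
        SAW.criticalFugacity ^ w.1.length * Real.exp (0 * (SAW.xEnd w.1 : ℝ) / W)) ≤ 1 := by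
  intro W y s
  simp only [zero_mul, zero_div, Real.exp_zero, mul_one]
  exact fittingSum_le_one W y s

/-- **Downward closure in `c` of the registered inequality**: if the tilted sum at `c` is `≤ 1`
then so is the tilted sum at every `c' ≤ c` (same `W, y, s`). [folklore] -/
theorem tiltedKraft_mono {c c' : ℝ} (hc : c' ≤ c) (W : ℕ) (y : ℤ)
    (s : Finset {w : List SAW.Step // SAW.IsIrrBridge w})
    (h : (∑ w ∈ s with (∀ i ≤ w.1.length, 0 ≤ y + SAW.traj w.1 i 1 ∧ y + SAW.traj w.1 i 1 < W),
      SAW.criticalFugacity ^ w.1.length * Real.exp (c * (SAW.xEnd w.1 : ℝ) / W)) ≤ 1) :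
    (∑ w ∈ s with (∀ i ≤ w.1.length, 0 ≤ y + SAW.traj w.1 i 1 ∧ y + SAW.traj w.1 i 1 < W),
      SAW.criticalFugacity ^ w.1.length * Real.exp (c' * (SAW.xEnd w.1 : ℝ) / W)) ≤ 1 :=
  (tiltedSum_mono hc W y s).trans h

/-- **S1 is downward closed in `c`**: the `∀ W y s` body of `stub_irrBridgeTiltedKraft` at `c`
implies it at every `c' ≤ c`; so S1 is exactly the claim that the infimum over `W` of the
row-sum (Kraft) thresholds `c_K(W)` is positive. [folklore] -/
theorem tiltedKraft_anti {c c' : ℝ} (hc : c' ≤ c)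
    (h : ∀ W : ℕ, 1 ≤ W → ∀ y : ℤ, 0 ≤ y → y < W →
      ∀ s : Finset {w : List SAW.Step // SAW.IsIrrBridge w},
        (∑ w ∈ s with (∀ i ≤ w.1.length, 0 ≤ y + SAW.traj w.1 i 1 ∧ y + SAW.traj w.1 i 1 < W),
          SAW.criticalFugacity ^ w.1.length * Real.exp (c * (SAW.xEnd w.1 : ℝ) / W)) ≤ 1) :
    ∀ W : ℕ, 1 ≤ W → ∀ y : ℤ, 0 ≤ y → y < W →
      ∀ s : Finset {w : List SAW.Step // SAW.IsIrrBridge w},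
        (∑ w ∈ s with (∀ i ≤ w.1.length, 0 ≤ y + SAW.traj w.1 i 1 ∧ y + SAW.traj w.1 i 1 < W),
          SAW.criticalFugacity ^ w.1.length * Real.exp (c' * (SAW.xEnd w.1 : ℝ) / W)) ≤ 1 :=
  fun W hW y hy0 hyW s => tiltedKraft_mono hc W y s (h W hW y hy0 hyW s)

/-- **S1 in width one, at `c = log 2`**: from start height `0` in width `1` only `[+e₀]` fits
(`TiltedKraft.eq_single_of_height_zero`), so the tilted sum over any `s` is at most
`x_c · exp (log 2 · 1) = 2 x_c ≤ 1` by the elementary `x_c ≤ 1/2` (`criticalFugacity_le_half`).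
(The sharp width-one threshold is `c_K(1) = log μ = 0.970…`.) [cite: MadrasSlade1993, §1.2, eq. (1.2.2)] -/
theorem tiltedKraft_width_one (s : Finset {w : List SAW.Step // SAW.IsIrrBridge w}) :
    (∑ w ∈ s with (∀ i ≤ w.1.length, 0 ≤ SAW.traj w.1 i 1 ∧ SAW.traj w.1 i 1 < 1),
      SAW.criticalFugacity ^ w.1.length * Real.exp (Real.log 2 * (SAW.xEnd w.1 : ℝ))) ≤ 1 := by
  have hsub : (s.filter fun w => ∀ i ≤ w.1.length, 0 ≤ SAW.traj w.1 i 1 ∧ SAW.traj w.1 i 1 < 1) ⊆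
      {⟨[0], SAW.Renewal.isIrrBridge_single⟩} := by
    intro w hw
    rw [Finset.mem_singleton]
    obtain ⟨-, hfit⟩ := Finset.mem_filter.1 hw
    exact Subtype.ext (eq_single_of_height_zero w.2 fun i hi => by have := hfit i hi; omega)
  refine (Finset.sum_le_sum_of_subset_of_nonneg hsub fun _ _ _ => ?_).trans ?_
  · exact mul_nonneg (pow_nonneg KestenIdentity.criticalFugacity_nonneg _) (Real.exp_nonneg _)
  · rw [Finset.sum_singleton]
    have hx : (SAW.xEnd [(0 : SAW.Step)] : ℝ) = 1 := by exact_mod_cast xEnd_single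
    rw [hx, mul_one, Real.exp_log two_pos, List.length_singleton, pow_one]
    linarith [SAW.criticalFugacity_le_half]

/-- **S1 in width one, registered form**: the `W = 1` instance of the body of
`stub_irrBridgeTiltedKraft` with `c = log 2` (the start height is forced to be `y = 0`).
[cite: MadrasSlade1993, §1.2, eq. (1.2.2)] -/
theorem tiltedKraft_width_one' :
    ∀ y : ℤ, 0 ≤ y → y < ((1 : ℕ) : ℤ) →
      ∀ s : Finset {w : List SAW.Step // SAW.IsIrrBridge w},
        (∑ w ∈ s with (∀ i ≤ w.1.length,
            0 ≤ y + SAW.traj w.1 i 1 ∧ y + SAW.traj w.1 i 1 < ((1 : ℕ) : ℤ)),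
          SAW.criticalFugacity ^ w.1.length *
            Real.exp (Real.log 2 * (SAW.xEnd w.1 : ℝ) / ((1 : ℕ) : ℝ))) ≤ 1 := by
  intro y hy0 hy1 s
  obtain rfl : y = 0 := by push_cast at hy1; omega
  simp only [Nat.cast_one, zero_add, div_one]
  exact tiltedKraft_width_one s

/-! ## What S1 demands: necessary conditions on the confinement defect

With `θ_W(y) := 1 - sup_s Σ_{fits} x_c^{|β|}` (Kesten's defect of the strip), S1 with constant `c`
forces `θ_W(y) ≥ 1 - e^{-c/W}` and `(c/W) Σ_{fits} x_c^{|β|} span β ≤ θ_W(y)` uniformly in `W, y`.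
Neither is known; the proved lower bound on the defect is `x_c^{W+1}` (`fittingSum_add_pow_le_one`). -/

/-- **S1 forces a `1/W` defect.** If the tilted sum at `c ≥ 0` over `s` is `≤ 1`, then the
untilted fitting sum over `s` is `≤ exp (-c/W)`: each fitting member of `s` is a non-empty
bridge, so its span is `≥ 1` and its tilt factor is `≥ exp (c/W)`. Hence S1 with constant `c`
gives `Σ_{fits} x_c^{|β|} ≤ e^{-c/W}`, i.e. a confinement defect `≥ 1 - e^{-c/W}` for all
`W ≥ 1` and `0 ≤ y < W`, against the proved `x_c^{W+1}` (`TiltedKraft.fittingSum_add_pow_le_one`).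
[folklore] -/
theorem fittingSum_le_exp_neg_of_tiltedKraft {c : ℝ} (hc : 0 ≤ c) (W : ℕ) (y : ℤ)
    (s : Finset {w : List SAW.Step // SAW.IsIrrBridge w})
    (h : (∑ w ∈ s with (∀ i ≤ w.1.length, 0 ≤ y + SAW.traj w.1 i 1 ∧ y + SAW.traj w.1 i 1 < W),
      SAW.criticalFugacity ^ w.1.length * Real.exp (c * (SAW.xEnd w.1 : ℝ) / W)) ≤ 1) :
    (∑ w ∈ s with (∀ i ≤ w.1.length, 0 ≤ y + SAW.traj w.1 i 1 ∧ y + SAW.traj w.1 i 1 < W),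
      SAW.criticalFugacity ^ w.1.length) ≤ Real.exp (-(c / W)) := by
  have hpos := Real.exp_pos (c / W)
  have key : Real.exp (c / W) *
      (∑ w ∈ s with (∀ i ≤ w.1.length, 0 ≤ y + SAW.traj w.1 i 1 ∧ y + SAW.traj w.1 i 1 < W),
        SAW.criticalFugacity ^ w.1.length) ≤ 1 := by
    rw [Finset.mul_sum]
    refine le_trans (Finset.sum_le_sum fun w _ => ?_) h
    rw [mul_comm]
    refine mul_le_mul_of_nonneg_left (Real.exp_le_exp.2 ?_)
      (pow_nonneg KestenIdentity.criticalFugacity_nonneg _)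
    have h1 : (1 : ℤ) ≤ SAW.xEnd w.1 := by -- the span of a non-empty bridge is `≥ 1`
      have := ((SAW.isBridgeW_iff w.1).1 w.2.bridge 1 le_rfl (List.length_pos_iff.2 w.2.ne_nil)).1
      linarith [w.2.bridge.xAt_le 1]
    have h1' : (1 : ℝ) ≤ (SAW.xEnd w.1 : ℝ) := by exact_mod_cast h1
    have h2 : c ≤ c * (SAW.xEnd w.1 : ℝ) := by nlinarith
    exact div_le_div_of_nonneg_right h2 (Nat.cast_nonneg W)
  rw [Real.exp_neg, ← one_div, le_div_iff₀ hpos, mul_comm]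
  exact key

/-- **First-order necessary condition.** `1 + t ≤ eᵗ` turns the tilted inequality at `c` (any
sign) over `s` into `Σ_{fits} x_c^{|β|} + (c/W) Σ_{fits} x_c^{|β|} span β ≤ 1`: the first span
moment of the fitting members is at most `(W/c) (1 - Σ_{fits} x_c^{|β|})`, so in the limit over
`s` the tilt's first-order cost `(c/W) Σ_{fits} x_c^{|β|} span β` must be paid by the defect
`θ_W(y)` (both predicted `≍ W^{-3/4}`: the hyperscaling coincidence). [folklore] -/
theorem fittingSum_add_firstMoment_le_of_tiltedKraft {c : ℝ} (W : ℕ) (y : ℤ)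
    (s : Finset {w : List SAW.Step // SAW.IsIrrBridge w})
    (h : (∑ w ∈ s with (∀ i ≤ w.1.length, 0 ≤ y + SAW.traj w.1 i 1 ∧ y + SAW.traj w.1 i 1 < W),
      SAW.criticalFugacity ^ w.1.length * Real.exp (c * (SAW.xEnd w.1 : ℝ) / W)) ≤ 1) :
    (∑ w ∈ s with (∀ i ≤ w.1.length, 0 ≤ y + SAW.traj w.1 i 1 ∧ y + SAW.traj w.1 i 1 < W),
        SAW.criticalFugacity ^ w.1.length) +
      c / W * (∑ w ∈ s with (∀ i ≤ w.1.length, 0 ≤ y + SAW.traj w.1 i 1 ∧ y + SAW.traj w.1 i 1 < W),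
        SAW.criticalFugacity ^ w.1.length * (SAW.xEnd w.1 : ℝ)) ≤ 1 := by
  rw [Finset.mul_sum, ← Finset.sum_add_distrib]
  refine le_trans (Finset.sum_le_sum fun w _ => ?_) h
  have e : SAW.criticalFugacity ^ w.1.length +
      c / W * (SAW.criticalFugacity ^ w.1.length * (SAW.xEnd w.1 : ℝ)) =
      SAW.criticalFugacity ^ w.1.length * (c * (SAW.xEnd w.1 : ℝ) / W + 1) := by ring
  rw [e]
  exact mul_le_mul_of_nonneg_left (Real.add_one_le_exp _)
    (pow_nonneg KestenIdentity.criticalFugacity_nonneg _)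

end Summit.CriticalPhenomena.SAWScalingLimit.Theorems
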